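import Literature.NumberTheory.Weil1964.AdicCompletionWeilIndexHilbertSymbol
import Literature.NumberTheory.Weil1964.LocalWeilIndexQuadraticForm
import Literature.NumberTheory.QuadraticForms.HilbertSymbolBilinear
import HarnessLib

/-!
# The Weil index of a norm form `a · N_{K_v(√d)/K_v}` and of the restriction of scalars of a diagonal
# hermitian form: `γ = ε(a) · γ⁰`, `γ⁰ = γ(1) γ(−d)` ([HarrisKudlaSweet1996, §1 (1.16)]; [Weil1964, n° 28])

Topic `NumberTheory/Weil1964`; namespace `Literature.NumberTheory.Weil1964`.  KERNEL only (definitions with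
bodies + theorems; no named fact, no `sorry`).  Sequel of `AdicCompletionWeilIndexHilbertSymbol` (Weil's law (28)
at a finite place `K_v`: `γ(b) γ(−ab) = (a, b)_v γ(1) γ(−a)`).

For a quadratic extension `E_w = K_v(√d)` of the local field `K_v` the NORM FORM scaled by `a ∈ K_vˣ` is the binary
quadratic form `a(x² − d y²) = a x² + (−a d) y²`; its Weil index is

  `γ(a · N) = γ(a) γ(−d a) = (d, a)_v · γ⁰`,   `γ⁰ := γ(1) γ(−d)` = the Weil index of the norm form itself

(`weilIndex_mul_weilIndex_neg_mul_eq`, `weilIndexQF_scaledNormForm`), i.e. `ε_{E_w/K_v}(a) · γ⁰` with `ε = (d, ·)_v`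
the quadratic character of `E_w/K_v`; and for the restriction of scalars of the DIAGONAL hermitian form
`⟨a₁, …, a_r⟩` over `E_w` (= the quadratic form `Σᵢ aᵢ N(zᵢ)` on `K_v^{2r}`),
`γ = (d, ∏ aᵢ)_v · (γ⁰)^r` (`weilIndexQF_diagonalHermitianNorm`) — formula (1.16) of [HarrisKudlaSweet1996] for
`γ_F(η ∘ R_V)`, `V` hermitian of dimension `r`: `(Δ, det V)_F · γ_F(−Δ, η)^r γ_F(−1, η)^{−r}` up to the normalisation
of `γ⁰` (theirs: `γ_F(−Δ,η)γ_F(−1,η)⁻¹ = γ(−Δ)γ(−1)⁻¹`, ours: `γ(1)γ(−d)`; the two agree by `γ(1)γ(−1) = 1`, tree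
`weilIndexQF'_eq_one_of_hyperbolic` ∕ `weilIndex_one_mul_weilIndex_neg_sq`).  This is input (L3) of the splitting of the
metaplectic cocycle over the quasi-split unitary group ([Kudla1994, Thm 3.1]).

## References

* M. Harris, S. S. Kudla, W. J. Sweet, J. Amer. Math. Soc. 9 (1996), §1 (1.16) [HarrisKudlaSweet1996].
* A. Weil, Acta Math. 111 (1964), Chap. II n° 28 (28) [Weil1964].
* S. S. Kudla, Israel J. Math. 87 (1994), Thm 3.1 [Kudla1994].
-/

set_option autoImplicit false

noncomputable section

open MeasureTheory NumberField IsDedekindDomain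
open Literature.NumberTheory.QuadraticForms

namespace Literature.NumberTheory.Weil1964

variable (K : Type) [Field K] [NumberField K] (v : HeightOneSpectrum (𝓞 K))

/-- `2` is invertible in `K_v` (characteristic `0`). [folklore] -/
private instance instInvertibleTwoAdicCompletion' : Invertible (2 : v.adicCompletion K) :=
  haveI : CharZero (v.adicCompletion K) := charZero_of_injective_algebraMap (algebraMap K _).injective
  invertibleOfNonzero two_ne_zero

variable [MeasurableSpace (v.adicCompletion K)] [BorelSpace (v.adicCompletion K)]
  (μ : Measure (v.adicCompletion K)) [μ.IsAddHaarMeasure] {ψ : AddChar (v.adicCompletion K) Circle}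

/-- **`γ⁰_d := γ(1) γ(−d)`** — the Weil index of the norm form `x² − d y²` of `K_v(√d) ∕ K_v`
([HarrisKudlaSweet1996, §1 (1.16)]'s `γ_F(−Δ, η) γ_F(−1, η)⁻¹ · γ_F(η)²`-type constant in the normalisation
`γ(1)γ(−d)`). [cite: HarrisKudlaSweet1996, §1 (1.16)] -/
def normFormIndex (ψ : AddChar (v.adicCompletion K) Circle) (μ : Measure (v.adicCompletion K))
    (d : v.adicCompletion K) : ℂ :=
  weilIndex ψ μ 1 * weilIndex ψ μ (-d)

omit [BorelSpace (v.adicCompletion K)] [μ.IsAddHaarMeasure] in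
/-- unfolding. [cite: HarrisKudlaSweet1996, §1 (1.16)] -/
theorem normFormIndex_def (d : v.adicCompletion K) : normFormIndex K v ψ μ d = weilIndex ψ μ 1 * weilIndex ψ μ (-d) :=
  rfl

/-- **`γ(a) γ(−d a) = (d, a)_v · γ⁰_d`** — Weil's law (28) at `(d, a)` (tree `weilIndex_hilbertSymbol_law_adicCompletion`):
the Weil index of the scaled norm form `a · N_{K_v(√d)/K_v}` factor by factor. [cite: Weil1964, Chap. II n° 28, (28), p. 176] -/
theorem weilIndex_mul_weilIndex_neg_mul_eq (hψ : ψ.IsContinuousNontrivial) {a d : v.adicCompletion K}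
    (ha : a ≠ 0) (hd : d ≠ 0) :
    weilIndex ψ μ a * weilIndex ψ μ (-(d * a)) =
      (hilbertSymbol (v.adicCompletion K) d a : ℂ) * normFormIndex K v ψ μ d :=
  weilIndex_hilbertSymbol_law_adicCompletion K v μ hψ hd ha

/-- the coefficient vector `(a, −d a)` of the scaled norm form `a(x² − d y²)` on `K_v²`. [folklore] -/
def scaledNormCoeff (a d : v.adicCompletion K) : Fin 2 → v.adicCompletion K := ![a, -(d * a)]

/-- **the Weil index of the scaled norm form** `a (x² − d y²) = weightedSumSquares (a, −d a)`:
`γ = (d, a)_v · γ⁰_d = ε_{K_v(√d)/K_v}(a) γ⁰_d`. [cite: HarrisKudlaSweet1996, §1 (1.16)] -/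
theorem weilIndexQF_scaledNormForm (hψ : ψ.IsContinuousNontrivial) {a d : v.adicCompletion K} (ha : a ≠ 0)
    (hd : d ≠ 0) :
    weilIndexQF ψ μ (QuadraticMap.weightedSumSquares (v.adicCompletion K) (scaledNormCoeff K v a d)) =
      (hilbertSymbol (v.adicCompletion K) d a : ℂ) * normFormIndex K v ψ μ d := by
  have hc : ∀ i, scaledNormCoeff K v a d i ≠ 0 := by
    intro i
    fin_cases i
    · exact ha
    · exact neg_ne_zero.2 (mul_ne_zero hd ha)
  rw [weilIndexQF_weightedSumSquares μ hψ hc, Fin.prod_univ_two]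
  exact weilIndex_mul_weilIndex_neg_mul_eq K v μ hψ ha hd

/-- the coefficient vector of `Σᵢ aᵢ (xᵢ² − d yᵢ²)` on `K_v^{r × 2}`: `(i, 0) ↦ aᵢ`, `(i, 1) ↦ −d aᵢ` — the restriction of
scalars to `K_v` of the diagonal hermitian form `⟨a₁, …, a_r⟩` over `K_v(√d)`. [folklore] -/
def diagHermCoeff {r : ℕ} (a : Fin r → v.adicCompletion K) (d : v.adicCompletion K) :
    Fin r × Fin 2 → v.adicCompletion K :=
  fun p => scaledNormCoeff K v (a p.1) d p.2

omit [MeasurableSpace (v.adicCompletion K)] [BorelSpace (v.adicCompletion K)] in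
/-- `∏ᵢ (d, aᵢ)_v = (d, ∏ᵢ aᵢ)_v` (multiplicativity of the local Hilbert symbol in the second variable).
[cite: Omeara1963, §63B (formulas after 63:10)] -/
theorem prod_hilbertSymbol_adicCompletion_right {r : ℕ} (a : Fin r → v.adicCompletion K) (ha : ∀ i, a i ≠ 0)
    {d : v.adicCompletion K} (hd : d ≠ 0) :
    ∏ i, (hilbertSymbol (v.adicCompletion K) d (a i) : ℂ) = hilbertSymbol (v.adicCompletion K) d (∏ i, a i) := by
  induction r with
  | zero => simp [hilbertSymbol_one_right]
  | succ r ih =>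
    rw [Fin.prod_univ_castSucc, Fin.prod_univ_castSucc, ih (fun i => a i.castSucc) (fun i => ha _),
      hilbertSymbol_adicCompletion_mul_right K v (Finset.prod_ne_zero_iff.2 fun i _ => ha _) (ha _) hd]
    push_cast
    ring

/-- **the Weil index of the restriction of scalars of a diagonal hermitian form of rank `r`**:
`γ(Σᵢ aᵢ N(zᵢ)) = (d, ∏ᵢ aᵢ)_v · (γ⁰_d)^r = ε(det) · (γ⁰)^r` — [HarrisKudlaSweet1996, §1 (1.16)]
`γ_F(η ∘ R_V) = (Δ, det V)_F γ_F(−Δ, η)^m γ_F(−1, η)^{−m}` in the normalisation `γ⁰ = γ(1)γ(−d)`.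
[cite: HarrisKudlaSweet1996, §1 (1.16)] -/
theorem weilIndexQF_diagonalHermitianNorm (hψ : ψ.IsContinuousNontrivial) {r : ℕ} {a : Fin r → v.adicCompletion K}
    (ha : ∀ i, a i ≠ 0) {d : v.adicCompletion K} (hd : d ≠ 0) :
    weilIndexQF ψ μ (QuadraticMap.weightedSumSquares (v.adicCompletion K) (diagHermCoeff K v a d)) =
      (hilbertSymbol (v.adicCompletion K) d (∏ i, a i) : ℂ) * normFormIndex K v ψ μ d ^ r := by
  have hc : ∀ p, diagHermCoeff K v a d p ≠ 0 := by
    rintro ⟨i, j⟩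
    fin_cases j
    · exact ha i
    · exact neg_ne_zero.2 (mul_ne_zero hd (ha i))
  rw [weilIndexQF_weightedSumSquares μ hψ hc, Fintype.prod_prod_type]
  simp only [diagHermCoeff, Fin.prod_univ_two]
  -- each factor: `γ(aᵢ) γ(−d aᵢ) = (d, aᵢ) γ⁰`
  have hfac : ∀ i, weilIndex ψ μ (scaledNormCoeff K v (a i) d 0) * weilIndex ψ μ (scaledNormCoeff K v (a i) d 1) =
      (hilbertSymbol (v.adicCompletion K) d (a i) : ℂ) * normFormIndex K v ψ μ d := fun i =>
    weilIndex_mul_weilIndex_neg_mul_eq K v μ hψ (ha i) hd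
  simp only [hfac, Finset.prod_mul_distrib, Finset.prod_const, Finset.card_univ, Fintype.card_fin]
  congr 1
  exact prod_hilbertSymbol_adicCompletion_right K v a ha hd

end Literature.NumberTheory.Weil1964

end
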